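import Summits.CriticalPhenomena.PercolationContinuityZ3.Theorems.PercNearOneGluingNoHeavyQuantLongTailTripleWideCost
import Summits.CriticalPhenomena.PercolationContinuityZ3.Theorems.PercNearOneGluingNoHeavyQuantLongTailTripleWide4Cost
import HarnessLib

/-!
# QUANT lane R8, T-DEC: THE LONG-TAIL TRIPLE HUB BEYOND `3lo`, ROUTE FILE — the THREE-BRANCH route of the low atom `3lo` of the width-3 hub
# `S(γ₁) ∗ S(γ₂) ∗ S(γ₃)` of shape `{lo, lo+K; γ}`, WHOLE RANGE `3lo ≤ K ≤ 4lo`, at ONE outer gate with ONE positive low (census-1 gen 33)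

builds on p205010 (kernel theorem, internal audit signed; external expert review pending)

Support file (`--supports stmt-CriticalPhenomena-4575`), QUANT lane seat prim-quant-census-1 (gen 33); memo
`run/shared/lean/prim/quant/prim-quant-census-1/g33/WIDE3-G33.md` §2.  Theorems only, standard axioms, no sorries.  VERBATIM twin of
`tripleWide_routeOne` (`…QuantLongTailTripleWideRoute`, `2K ≤ 7lo`) for the whole range `K ≤ 4lo`, calling the `K ≤ 4lo` certificates `ltTopW_*`
(`…QuantLongTailTripleTopAlgW4`) and `tripleWide4_costTopOne` (`…QuantLongTailTripleWide4Cost`); the SDEC theorem is `…QuantLongTailTripleWide4Hub`.  Same architecture as gen 32's `tripleHubLong_route` (`K ≤ 3lo`, two branches,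
top never used); beyond `3lo` the atom `3lo+K` may be FAR (`T < 3lo+K`, cost-safe), the second atom's credit capacity `(T−6lo)(u₀+u₂) ≤ 2K·u₂` is no
longer unconditional and becomes the second branch's test, and the TOP `3lo+3K` is the third branch (ρ-capacity `ltTop_capRho_one`, floor capacity
`ltTop_capTop_oneQ` under both exhausted tests, ρ-cost `ltTop_costRho_oneA/oneB`, floor cost `tripleWide_costTopOne`).
* **`tripleWide4_routeOne`** — THE CERTIFICATE per outer gate in the one-low regime `6lo < T ≤ 6lo+2K` (`ν` the gated law, `T = aT₀`, `y = ax`): a target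
  `t ∈ {3lo+K, 3lo+2K, 3lo+3K}` for the low `3lo` with `T < 3lo + t`, capacity `freeRate(y,T,3lo,t)·ν(3lo) ≤ ν(t)` and torque cost within the budget.
The two-low regime `T > 6lo+2K` (both lows to the top) is `tripleWide4_routeTwo` (`…QuantLongTailTripleWide4RouteTwo`).
NUMERICS (memo §1, `g33/code/exp1_threebranch.py`, exact rationals, 18 shapes `3 ≤ K/lo ≤ 9/2`): 0 failures of every inequality used.

HONEST STATUS.  Route bookkeeping; `SiblingStep`, `GluedDominatedMass`, `SDECConvClosed`, `FarTreeRow` OPEN; RATE class (log\*) / honest sentence of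
`run/shared/lean/prim/quant/README.md` unchanged.  [this work].  Nothing here is cited as a published result.  The gluing rows served
[cite: KozmaNitzan2024, Conjecture 3 (p. 15)]; product measure [cite: Grimmett1999, §1.3 p. 10].
-/

noncomputable section
open scoped BigOperators

namespace Summit.CriticalPhenomena.PercolationContinuityZ3.Theorems
namespace Quant
namespace LawDec

/-! ### The one-low route of the wide triple hub -/

set_option maxHeartbeats 800000 in
/-- **the route of the wide triple hub at one outer gate, one low, `3lo ≤ K ≤ 4lo`** ( `ν` the gated law with masses `a·u₀..a·u₃` at
`3lo, 3lo+K, 3lo+2K, 3lo+3K`, `y = ax` the gated floor, `T = a(3lo + K(g₁+g₂+g₃))` the gated mean with `6lo < T ≤ 6lo+2K`, `g₁` the least gate): a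
target for the low atom `3lo` — the atom `3lo+K` while `(T−6lo)(ν(3lo)+ν(3lo+K)) ≤ K·ν(3lo+K)`, else the atom `3lo+2K` while
`(T−6lo)(ν(3lo)+ν(3lo+2K)) ≤ 2K·ν(3lo+2K)`, else the top — with its compatibility, capacity and torque-cost facts. [this work] -/
theorem tripleWide4_routeOne (lo K : ℕ) (hloK : lo < K) (hK3 : 3 * lo ≤ K) (hK8 : K ≤ 4 * lo) (ν : ℕ → ℝ) (y T a g₁ g₂ g₃ x : ℝ)
    (g0 : ∀ h, 0 ≤ ν h) (h12 : g₁ ≤ g₂) (h13 : g₁ ≤ g₃) (hg : (lo : ℝ) ≤ K * g₁) (h21 : g₂ < 1) (h31 : g₃ < 1) (hx0 : 0 < x)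
    (hxg : x * ((lo : ℝ) + K) ≤ lo + K * g₁) (ha0 : 0 < a) (ha1 : a ≤ 1) (hy : y = a * x)
    (hT : T = a * (3 * (lo : ℝ) + K * (g₁ + g₂ + g₃))) (hT6 : 6 * (lo : ℝ) < T) (hT62 : T ≤ 6 * (lo : ℝ) + 2 * K)
    (v0 : ν (3 * lo) = a * ((1 - g₁) * (1 - g₂) * (1 - g₃)))
    (v1 : ν (3 * lo + K) = a * (g₁ * (1 - g₂) * (1 - g₃) + g₂ * (1 - g₁) * (1 - g₃) + g₃ * (1 - g₁) * (1 - g₂)))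
    (v2 : ν (3 * lo + 2 * K) = a * (g₁ * g₂ * (1 - g₃) + g₁ * g₃ * (1 - g₂) + g₂ * g₃ * (1 - g₁)))
    (v3 : ν (3 * lo + 3 * K) = a * (g₁ * g₂ * g₃)) :
    ∃ t : ℕ, (t = 3 * lo + K ∨ t = 3 * lo + 2 * K ∨ t = 3 * lo + 3 * K) ∧ (T < ((3 * lo : ℕ) : ℝ) + (t : ℝ)) ∧
      freeRate y T (3 * lo) t * ν (3 * lo) ≤ ν t ∧
      (if T < (t : ℝ) then ((t : ℝ) - T) * (freeRate y T (3 * lo) t * ν (3 * lo)) else 0)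
        ≤ ∑ l ∈ Finset.range (3 * lo + 3 * K + 1), (if (1 ≤ l ∧ (l : ℝ) < T) then ν l * (T - l) else 0) := by
  have hlo1 : 1 ≤ lo := by omega
  have hlo0 : (0 : ℝ) < lo := by exact_mod_cast (show 0 < lo by omega)
  have hK3R : 3 * (lo : ℝ) ≤ K := by exact_mod_cast hK3
  have hK4R : (K : ℝ) ≤ 4 * lo := by exact_mod_cast hK8
  have hK0 : (0 : ℝ) < K := by linarith
  have hg10 : 0 < g₁ := by
    by_contra hc; push Not at hc
    have : (K : ℝ) * g₁ ≤ 0 := mul_nonpos_of_nonneg_of_nonpos hK0.le hc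
    linarith
  have hg11 : g₁ < 1 := lt_of_le_of_lt h12 h21
  have hg2 : 0 ≤ g₂ := le_trans hg10.le h12
  have hg3 : 0 ≤ g₃ := le_trans hg10.le h13
  have hg₂K : (lo : ℝ) ≤ K * g₂ := le_trans hg (mul_le_mul_of_nonneg_left h12 hK0.le)
  have hg₃K : (lo : ℝ) ≤ K * g₃ := le_trans hg (mul_le_mul_of_nonneg_left h13 hK0.le)
  set u0 : ℝ := (1 - g₁) * (1 - g₂) * (1 - g₃) with hu0
  set u1 : ℝ := g₁ * (1 - g₂) * (1 - g₃) + g₂ * (1 - g₁) * (1 - g₃) + g₃ * (1 - g₁) * (1 - g₂) with hu1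
  set u2 : ℝ := g₁ * g₂ * (1 - g₃) + g₁ * g₃ * (1 - g₂) + g₂ * g₃ * (1 - g₁) with hu2
  set u3 : ℝ := g₁ * g₂ * g₃ with hu3
  have hu0p : 0 < u0 := mul_pos (mul_pos (by linarith) (by linarith)) (by linarith)
  have hu1n : 0 ≤ u1 := by rw [hu1]; positivity
  have hu2n : 0 ≤ u2 := by
    rw [hu2]; have := sub_nonneg.2 hg11.le; have := sub_nonneg.2 h21.le; have := sub_nonneg.2 h31.le; positivity
  have hu3n : 0 ≤ u3 := by rw [hu3]; positivity
  set W : ℝ := u0 + u1 with hW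
  have hWp : 0 < W := by linarith
  set T₀ : ℝ := 3 * (lo : ℝ) + K * (g₁ + g₂ + g₃) with hT₀
  have hT0p : 0 < T₀ := by
    have := mul_pos hK0 (by linarith : 0 < g₁ + g₂ + g₃); rw [hT₀]; linarith
  have hTle : T ≤ T₀ := by
    have := mul_le_mul_of_nonneg_right ha1 hT0p.le; rw [hT]; linarith
  have hT0top : T₀ < 3 * (lo : ℝ) + 3 * K := by
    have := mul_lt_mul_of_pos_left (by linarith : g₁ + g₂ + g₃ < 3) hK0; rw [hT₀]; linarith
  have hT0g : 3 * ((lo : ℝ) + K * g₁) ≤ T₀ := by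
    have := mul_le_mul_of_nonneg_left (show 3 * g₁ ≤ g₁ + g₂ + g₃ by linarith) hK0.le; rw [hT₀]; linarith
  have hx1 : x < 1 := by
    have : (lo : ℝ) + K * g₁ < lo + K := by have := mul_lt_mul_of_pos_left hg11 hK0; linarith
    by_contra hc; push Not at hc
    have : 1 * ((lo : ℝ) + K) ≤ x * (lo + K) := mul_le_mul_of_nonneg_right hc (by linarith)
    linarith
  have hyx : y ≤ x := by rw [hy]; have := mul_le_mul_of_nonneg_right ha1 hx0.le; linarith
  have hy1 : y < 1 := lt_of_le_of_lt hyx hx1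
  have hB0 : (0 : ℝ) < (lo : ℝ) + K := by linarith
  have hxB : x * (K : ℝ) ≤ lo + K * g₁ := by
    have := mul_nonneg hx0.le hlo0.le; linarith
  have hxu1 : x * W ≤ u1 := by
    have h1 := ltTriple_capMid (lo : ℝ) K g₁ g₂ g₃ hK0.le hg10.le hg h12 h13 h21.le h31.le
    rw [← hu0, ← hu1, ← hW] at h1
    have h2 : x * ((lo : ℝ) + K) * W ≤ ((lo : ℝ) + K * g₁) * W := mul_le_mul_of_nonneg_right hxg hWp.le
    have h3 : ((lo : ℝ) + K) * (x * W) ≤ ((lo : ℝ) + K) * u1 := by linarith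
    exact le_of_mul_le_mul_left h3 hB0
  clear_value u0 u1 u2 u3 W T₀
  set D : ℝ := T - 6 * (lo : ℝ) with hD
  have hDp : 0 < D := by rw [hD]; linarith
  have hDle : D ≤ K * (g₁ + g₂ + g₃) - 3 * lo := by have h := hTle; rw [hT₀] at h; rw [hD]; linarith
  have hD2K : D ≤ 2 * K := by rw [hD]; linarith
  clear_value D
  set F : ℕ → ℝ := fun l => if (1 ≤ l ∧ (l : ℝ) < T) then ν l * (T - l) else 0 with hF
  clear_value F
  have Fnn : ∀ l ∈ Finset.range (3 * lo + 3 * K + 1), 0 ≤ F l := by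
    intro l _; rw [hF]; dsimp only; split_ifs with hc
    · exact mul_nonneg (g0 l) (by linarith [hc.2])
    · exact le_rfl
  have Fge : ∀ l : ℕ, 1 ≤ l → ν l * (T - l) ≤ F l := by
    intro l hl; rw [hF]; dsimp only; split_ifs with hc
    · exact le_rfl
    · have hle : T ≤ (l : ℝ) := by
        by_contra hlt; push Not at hlt; exact hc ⟨hl, hlt⟩
      exact mul_nonpos_of_nonneg_of_nonpos (g0 l) (by linarith)
  have c3lo : ((3 * lo : ℕ) : ℝ) = 3 * (lo : ℝ) := by push_cast; ring
  have cA1 : ((3 * lo + K : ℕ) : ℝ) = 3 * (lo : ℝ) + K := by push_cast; ring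
  have cA2 : ((3 * lo + 2 * K : ℕ) : ℝ) = 3 * (lo : ℝ) + 2 * K := by push_cast; ring
  have Flo : ν (3 * lo) * (T - 3 * (lo : ℝ)) ≤ F (3 * lo) := by have := Fge (3 * lo) (by omega); rw [c3lo] at this; exact this
  have Fmid : ν (3 * lo + K) * (T - (3 * (lo : ℝ) + K)) ≤ F (3 * lo + K) := by have := Fge (3 * lo + K) (by omega); rw [cA1] at this; exact this
  have Ftop : ν (3 * lo + 2 * K) * max (T - (3 * (lo : ℝ) + 2 * K)) 0 ≤ F (3 * lo + 2 * K) := by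
    rcases le_total (T - (3 * (lo : ℝ) + 2 * K)) 0 with hle | hle
    · rw [max_eq_right hle, mul_zero]; exact Fnn _ (Finset.mem_range.2 (by omega))
    · rw [max_eq_left hle]; have := Fge (3 * lo + 2 * K) (by omega); rw [cA2] at this; exact this
  have bud3 : ν (3 * lo) * (T - 3 * (lo : ℝ)) + ν (3 * lo + K) * (T - (3 * (lo : ℝ) + K)) + ν (3 * lo + 2 * K) * max (T - (3 * (lo : ℝ) + 2 * K)) 0
      ≤ ∑ l ∈ Finset.range (3 * lo + 3 * K + 1), F l := by
    have hsub : ({3 * lo, 3 * lo + K, 3 * lo + 2 * K} : Finset ℕ) ⊆ Finset.range (3 * lo + 3 * K + 1) := by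
      intro l hl; simp only [Finset.mem_insert, Finset.mem_singleton] at hl; simp only [Finset.mem_range]; omega
    have hs := Finset.sum_le_sum_of_subset_of_nonneg hsub (fun l hl _ => Fnn l hl)
    have e : ∑ l ∈ ({3 * lo, 3 * lo + K, 3 * lo + 2 * K} : Finset ℕ), F l = F (3 * lo) + (F (3 * lo + K) + F (3 * lo + 2 * K)) := by
      have n1 : 3 * lo ∉ ({3 * lo + K, 3 * lo + 2 * K} : Finset ℕ) := by
        simp only [Finset.mem_insert, Finset.mem_singleton]; omega
      have n2 : 3 * lo + K ∉ ({3 * lo + 2 * K} : Finset ℕ) := by simp only [Finset.mem_singleton]; omega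
      rw [Finset.sum_insert n1, Finset.sum_insert n2, Finset.sum_singleton]
    rw [e] at hs; linarith
  have bud2 : ν (3 * lo) * (T - 3 * (lo : ℝ)) + ν (3 * lo + K) * (T - (3 * (lo : ℝ) + K)) ≤ ∑ l ∈ Finset.range (3 * lo + 3 * K + 1), F l := by
    linarith [mul_nonneg (g0 (3 * lo + 2 * K)) (le_max_right (T - (3 * (lo : ℝ) + 2 * K)) 0)]
  have bud0 : 0 ≤ ∑ l ∈ Finset.range (3 * lo + 3 * K + 1), F l := Finset.sum_nonneg Fnn
  have bud1 : ν (3 * lo) * (T - 3 * (lo : ℝ)) ≤ ∑ l ∈ Finset.range (3 * lo + 3 * K + 1), F l :=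
    le_trans Flo (Finset.single_le_sum Fnn (Finset.mem_range.2 (by omega : 3 * lo < 3 * lo + 3 * K + 1)))
  have eD : T - 2 * (((3 * lo : ℕ) : ℝ)) = D := by rw [c3lo, hD]; ring
  -- the three branches
  by_cases hbr : D * (ν (3 * lo) + ν (3 * lo + K)) ≤ K * ν (3 * lo + K)
  · -- branch 1: everything to `3lo + K` (maybe far, but cost-safe)
    have hbr' : D * W ≤ K * u1 := by
      rw [v0, v1] at hbr
      have : a * (D * W) ≤ a * (K * u1) := by rw [hW]; linarith
      exact le_of_mul_le_mul_left this ha0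
    have hDK : D < K := by
      by_contra hc; push Not at hc
      have h1 : K * W ≤ D * W := mul_le_mul_of_nonneg_right hc hWp.le
      have e : K * W = K * u0 + K * u1 := by rw [hW]; ring
      have h2 := mul_pos hK0 hu0p
      linarith
    have ed : (((3 * lo + K : ℕ) : ℝ) - ((3 * lo : ℕ) : ℝ)) = K := by push_cast; ring
    have eθ : freeRate y T (3 * lo) (3 * lo + K) = max y (D / K) / (1 - max y (D / K)) := by
      unfold freeRate; rw [ed, eD]
    have hρ1 : D / K < 1 := by rw [div_lt_one hK0]; exact hDK
    have hθ1 : max y (D / K) < 1 := max_lt hy1 hρ1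
    have hcap : max y (D / K) * (ν (3 * lo) + ν (3 * lo + K)) ≤ ν (3 * lo + K) := by
      rw [max_mul_of_nonneg _ _ (add_nonneg (g0 _) (g0 _))]
      refine max_le ?_ ?_
      · rw [v0, v1]
        have h1 : y * W ≤ x * W := mul_le_mul_of_nonneg_right hyx hWp.le
        have h2 : a * (y * W) ≤ a * u1 := mul_le_mul_of_nonneg_left (le_trans h1 hxu1) ha0.le
        rw [hW] at h2; linarith
      · rw [div_mul_eq_mul_div, div_le_iff₀ hK0]; rw [hW] at hbr'; linarith
    refine ⟨3 * lo + K, Or.inl rfl, by push_cast; linarith, ?_, ?_⟩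
    · rw [eθ]; exact rate_mul_le_of_theta hθ1 hcap (g0 _)
    · split_ifs with hfar
      · -- the atom `3lo+K` is far: the route is cost-safe (`θ·K ≤ T − 3lo`)
        refine le_trans ?_ bud1
        rw [eθ]
        refine cost_le_of_theta hθ1 ?_
        push_cast
        have hs : max y (D / K) * ((3 * (lo : ℝ) + K) - 3 * (lo : ℝ)) ≤ T - 3 * (lo : ℝ) := by
          have e : (3 * (lo : ℝ) + K) - 3 * (lo : ℝ) = K := by ring
          rw [e, max_mul_of_nonneg _ _ hK0.le, div_mul_cancel₀ _ hK0.ne']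
          refine max_le ?_ (by rw [hD]; linarith)
          have h1 : y * K ≤ x * K := mul_le_mul_of_nonneg_right hyx hK0.le
          have h2 : a * ((lo : ℝ) + K * g₁) ≤ 1 * ((lo : ℝ) + K * g₁) := mul_le_mul_of_nonneg_right ha1 (by linarith)
          have h3 : y * K = a * (x * K) := by rw [hy]; ring
          have h4 : a * (x * K) ≤ a * ((lo : ℝ) + K * g₁) := mul_le_mul_of_nonneg_left hxB ha0.le
          have h5 : a * (3 * ((lo : ℝ) + K * g₁)) ≤ a * T₀ := mul_le_mul_of_nonneg_left hT0g ha0.le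
          linarith
        have c := pieceBlob_costA (lo := 3 * (lo : ℝ)) hs (g0 (3 * lo))
        linarith
      · exact bud0
  · -- the middle-low credit is exhausted
    have hbr' : K * u1 < D * W := by
      have hc := lt_of_not_ge hbr
      rw [v0, v1] at hc
      have : a * (K * u1) < a * (D * W) := by rw [hW]; linarith
      exact lt_of_mul_lt_mul_left this ha0.le
    have htopAlg : K * u1 < (K * (g₁ + g₂ + g₃) - 3 * lo) * W := by
      have : D * W ≤ (K * (g₁ + g₂ + g₃) - 3 * lo) * W := mul_le_mul_of_nonneg_right hDle hWp.le
      linarith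
    -- automatic: `3lo + K ≤ T` (else the exhausted credit would force `u1 < u0/3`, but `K·u1 ≥ 3lo·u0`)
    have hTA1 : 3 * (lo : ℝ) + K ≤ T := by
      by_contra hc; push Not at hc
      have hDs : D < K - 3 * lo := by rw [hD]; linarith
      have h1 : 3 * (lo : ℝ) * u1 < (K - 3 * lo) * u0 := by
        have e : D * W = D * u0 + D * u1 := by rw [hW]; ring
        have h1a : D * u0 ≤ (K - 3 * lo) * u0 := mul_le_mul_of_nonneg_right hDs.le hu0p.le
        have h1b : D * u1 ≤ (K - 3 * lo) * u1 := mul_le_mul_of_nonneg_right hDs.le hu1n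
        linarith [hbr']
      have h2 : (g₁ + g₂ + g₃) * u0 ≤ u1 := by
        have e : u1 - (g₁ + g₂ + g₃) * u0 = g₁ * (1 - g₂) * (1 - g₃) * g₁ + g₂ * (1 - g₁) * (1 - g₃) * g₂ + g₃ * (1 - g₁) * (1 - g₂) * g₃ := by
          rw [hu1, hu0]; ring
        have : 0 ≤ g₁ * (1 - g₂) * (1 - g₃) * g₁ + g₂ * (1 - g₁) * (1 - g₃) * g₂ + g₃ * (1 - g₁) * (1 - g₂) * g₃ := by
          have := sub_nonneg.2 hg11.le; have := sub_nonneg.2 h21.le; have := sub_nonneg.2 h31.le; positivity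
        linarith
      have h3 : 3 * (lo : ℝ) * u0 ≤ K * u1 := by
        have h3a : K * ((g₁ + g₂ + g₃) * u0) ≤ K * u1 := mul_le_mul_of_nonneg_left h2 hK0.le
        have h3b : 3 * (lo : ℝ) * u0 ≤ K * (g₁ + g₂ + g₃) * u0 := mul_le_mul_of_nonneg_right (by linarith) hu0p.le
        linarith
      have h5 : (K - 3 * (lo : ℝ)) * u0 ≤ lo * u0 := mul_le_mul_of_nonneg_right (by linarith) hu0p.le
      have h6 : (K : ℝ) * u1 ≤ (4 * lo) * u1 := mul_le_mul_of_nonneg_right (by linarith) hu1n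
      linarith [mul_nonneg hlo0.le hu1n]
    by_cases hbr2 : D * (ν (3 * lo) + ν (3 * lo + 2 * K)) ≤ 2 * K * ν (3 * lo + 2 * K)
    · -- branch 2: everything to `3lo + 2K`
      have hbr2' : D * (u0 + u2) ≤ 2 * K * u2 := by
        rw [v0, v2] at hbr2
        have : a * (D * (u0 + u2)) ≤ a * (2 * K * u2) := by linarith
        exact le_of_mul_le_mul_left this ha0
      have hK20 : (0 : ℝ) < 2 * K := by linarith
      have hD2 : D < 2 * K := by
        by_contra hc; push Not at hc
        have h1 : 2 * K * (u0 + u2) ≤ D * (u0 + u2) := mul_le_mul_of_nonneg_right hc (add_nonneg hu0p.le hu2n)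
        have h2 := mul_pos hK20 hu0p
        linarith
      have ed : (((3 * lo + 2 * K : ℕ) : ℝ) - ((3 * lo : ℕ) : ℝ)) = 2 * K := by push_cast; ring
      have eθ : freeRate y T (3 * lo) (3 * lo + 2 * K) = max y (D / (2 * K)) / (1 - max y (D / (2 * K))) := by
        unfold freeRate; rw [ed, eD]
      have hρ1 : D / (2 * K) < 1 := by rw [div_lt_one hK20]; exact hD2
      have hθ1 : max y (D / (2 * K)) < 1 := max_lt hy1 hρ1
      have hxu2 : x * (u0 + u2) ≤ u2 := by
        have h1 := ltTriple_capTop_wide (lo : ℝ) K g₁ g₂ g₃ hlo0 hK3R hK4R hg h12 h13 h21.le h31.le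
          (by have h := htopAlg.le; rw [hW, hu0, hu1] at h; exact h)
        rw [← hu0, ← hu2] at h1
        have h2 : x * ((lo : ℝ) + K) * (u0 + u2) ≤ ((lo : ℝ) + K * g₁) * (u0 + u2) :=
          mul_le_mul_of_nonneg_right hxg (add_nonneg hu0p.le hu2n)
        have h3 : ((lo : ℝ) + K) * (x * (u0 + u2)) ≤ ((lo : ℝ) + K) * u2 := by linarith
        exact le_of_mul_le_mul_left h3 hB0
      have hcap : max y (D / (2 * K)) * (ν (3 * lo) + ν (3 * lo + 2 * K)) ≤ ν (3 * lo + 2 * K) := by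
        rw [max_mul_of_nonneg _ _ (add_nonneg (g0 _) (g0 _))]
        refine max_le ?_ ?_
        · rw [v0, v2]
          have h1 : y * (u0 + u2) ≤ x * (u0 + u2) := mul_le_mul_of_nonneg_right hyx (add_nonneg hu0p.le hu2n)
          have h2 : a * (y * (u0 + u2)) ≤ a * u2 := mul_le_mul_of_nonneg_left (le_trans h1 hxu2) ha0.le
          linarith
        · rw [div_mul_eq_mul_div, div_le_iff₀ hK20]; linarith
      refine ⟨3 * lo + 2 * K, Or.inr (Or.inl rfl), by push_cast; linarith, ?_, ?_⟩
      · rw [eθ]; exact rate_mul_le_of_theta hθ1 hcap (g0 _)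
      · split_ifs with hfar
        · -- the second atom is still far: torque cost
          refine le_trans ?_ bud2
          rw [eθ]
          refine cost_le_of_theta hθ1 ?_
          have hT2 : T ≤ 3 * (lo : ℝ) + 2 * K := by
            have : T < ((3 * lo + 2 * K : ℕ) : ℝ) := hfar
            push_cast at this; linarith
          push_cast
          rcases le_total y (D / (2 * K)) with hle | hle
          · rw [max_eq_right hle]
            have hs : D / (2 * K) * ((3 * (lo : ℝ) + 2 * K) - 3 * (lo : ℝ)) ≤ T - 3 * (lo : ℝ) := by
              have e : (3 * (lo : ℝ) + 2 * K) - 3 * (lo : ℝ) = 2 * K := by ring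
              rw [e, div_mul_cancel₀ _ hK20.ne', hD]; linarith
            have c := pieceBlob_costA (lo := 3 * (lo : ℝ)) hs (g0 (3 * lo))
            have hpos : 0 ≤ (1 - D / (2 * K)) * (ν (3 * lo + K) * (T - (3 * (lo : ℝ) + K))) :=
              mul_nonneg (by linarith) (mul_nonneg (g0 _) (by linarith))
            linarith
          · rw [max_eq_left hle, v0, v1]
            have hbrRaw : (K : ℝ) * (g₁ * (1 - g₂) * (1 - g₃) + g₂ * (1 - g₁) * (1 - g₃) + g₃ * (1 - g₁) * (1 - g₂))
                < (T - 6 * (lo : ℝ)) * ((1 - g₁) * (1 - g₂) * (1 - g₃)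
                  + (g₁ * (1 - g₂) * (1 - g₃) + g₂ * (1 - g₁) * (1 - g₃) + g₃ * (1 - g₁) * (1 - g₂))) := by
              have h := hbr'; rw [hD, hW, hu0, hu1] at h; exact h
            have hTleRaw : T ≤ 3 * (lo : ℝ) + K * (g₁ + g₂ + g₃) := by have h := hTle; rw [hT₀] at h; exact h
            have hΨT := tripleWide_costMid (lo : ℝ) K g₁ g₂ g₃ x T hlo0 hK3R hK4R hg h12 h13 h21 h31 hx0 hxg hbrRaw hTleRaw hT2
            rw [← hu0, ← hu1, ← hT₀] at hΨT
            have exT : x * T = y * T₀ := by rw [hy, hT]; ring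
            set R : ℝ := (1 - y) * (u0 * (T - 3 * lo) + u1 * (T - (3 * lo + K))) - (3 * lo + 2 * K - T) * y * u0 with hR
            have e : (T₀ - x * T) * (u0 * (T - 3 * lo) + u1 * (T - (3 * lo + K))) - (3 * lo + 2 * K - T) * (x * T) * u0 = T₀ * R := by
              rw [hR, exT]; ring
            have hR0 : 0 ≤ T₀ * R := by rw [← e]; exact hΨT
            have h6 : 0 ≤ R := nonneg_of_mul_nonneg_right hR0 hT0p
            have h7 : 0 ≤ a * R := mul_nonneg ha0.le h6
            rw [hR] at h7
            linarith [h7]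
        · exact bud0
    · -- branch 3: everything to the top `3lo + 3K`
      have hbr2' : 2 * K * u2 < D * (u0 + u2) := by
        have hc := lt_of_not_ge hbr2
        rw [v0, v2] at hc
        have : a * (2 * K * u2) < a * (D * (u0 + u2)) := by linarith
        exact lt_of_mul_lt_mul_left this ha0.le
      have hcap2A : 2 * K * u2 ≤ (K * (g₁ + g₂ + g₃) - 3 * lo) * (u0 + u2) := by
        have : D * (u0 + u2) ≤ (K * (g₁ + g₂ + g₃) - 3 * lo) * (u0 + u2) := mul_le_mul_of_nonneg_right hDle (add_nonneg hu0p.le hu2n)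
        linarith
      have hK30 : (0 : ℝ) < 3 * K := by linarith
      have ed : (((3 * lo + 3 * K : ℕ) : ℝ) - ((3 * lo : ℕ) : ℝ)) = 3 * K := by push_cast; ring
      have eθ : freeRate y T (3 * lo) (3 * lo + 3 * K) = max y (D / (3 * K)) / (1 - max y (D / (3 * K))) := by
        unfold freeRate; rw [ed, eD]
      have hρ1 : D / (3 * K) < 1 := by rw [div_lt_one hK30]; linarith
      have hθ1 : max y (D / (3 * K)) < 1 := max_lt hy1 hρ1
      -- capacities of the top
      have hxu3 : x * (u0 + u3) ≤ u3 := by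
        have h1 := ltTopW_capTop_oneQ (lo : ℝ) K g₁ g₂ g₃ hlo0 hK3R hK4R hg hg₂K hg₃K h12 h13 hg11.le h21.le h31.le
          (by have h := htopAlg.le; rw [hW, hu0, hu1] at h; exact h) (by have h := hcap2A; rw [hu0, hu2] at h; exact h)
        rw [← hu0, ← hu3] at h1
        have h2 : x * ((lo : ℝ) + K) * (u0 + u3) ≤ ((lo : ℝ) + K * g₁) * (u0 + u3) :=
          mul_le_mul_of_nonneg_right hxg (add_nonneg hu0p.le hu3n)
        have h3 : ((lo : ℝ) + K) * (x * (u0 + u3)) ≤ ((lo : ℝ) + K) * u3 := by linarith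
        exact le_of_mul_le_mul_left h3 hB0
      have hρu3 : D * (u0 + u3) ≤ 3 * K * u3 := by
        have h1 := ltTopW_capRho_one (lo : ℝ) K g₁ g₂ g₃ D hlo0 hK3R hK4R hg hg₂K hg₃K hg11.le h21.le h31.le hDp.le hD2K hDle
          (by have h := hbr'.le; rw [hW, hu0, hu1] at h; exact h)
        rw [← hu0, ← hu3] at h1; exact h1
      have hcap : max y (D / (3 * K)) * (ν (3 * lo) + ν (3 * lo + 3 * K)) ≤ ν (3 * lo + 3 * K) := by
        rw [max_mul_of_nonneg _ _ (add_nonneg (g0 _) (g0 _))]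
        refine max_le ?_ ?_
        · rw [v0, v3]
          have h1 : y * (u0 + u3) ≤ x * (u0 + u3) := mul_le_mul_of_nonneg_right hyx (add_nonneg hu0p.le hu3n)
          have h2 : a * (y * (u0 + u3)) ≤ a * u3 := mul_le_mul_of_nonneg_left (le_trans h1 hxu3) ha0.le
          linarith
        · rw [v0, v3, div_mul_eq_mul_div, div_le_iff₀ hK30]
          have h3 : a * (D * (u0 + u3)) ≤ a * (3 * K * u3) := mul_le_mul_of_nonneg_left hρu3 ha0.le
          linarith
      refine ⟨3 * lo + 3 * K, Or.inr (Or.inr rfl), by push_cast; linarith, ?_, ?_⟩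
      · rw [eθ]; exact rate_mul_le_of_theta hθ1 hcap (g0 _)
      · split_ifs with hfar
        swap
        · exact bud0
        refine le_trans ?_ bud3
        rw [eθ]
        refine cost_le_of_theta hθ1 ?_
        push_cast
        rcases le_total y (D / (3 * K)) with hle | hle
        · -- `θ = ρ = D/(3K)`: `ltTop_costRho_oneA` / `ltTop_costRho_oneB`
          rw [max_eq_right hle, v0, v1, v2]
          set Bud : ℝ := u0 * (D + 3 * lo) + u1 * (D + 3 * lo - K) + u2 * max (D + 3 * lo - 2 * K) 0 with hBud
          clear_value Bud
          have keyB : (3 * K - 3 * lo - D) * D * u0 ≤ (3 * K - D) * Bud := by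
            rcases le_total (D + 3 * lo - 2 * K) 0 with hs | hs
            · have hm : max (D + 3 * lo - 2 * K) 0 = 0 := max_eq_right hs
              have h1 := ltTopW_costRho_oneA (lo : ℝ) K g₁ g₂ g₃ D hlo0 hK3R hK4R hg hg₂K hg₃K hg11.le h21.le h31.le hDp.le
                (by linarith [hD, hTA1]) (by linarith) hDle (by have h := hbr'.le; rw [hW, hu0, hu1] at h; exact h)
              rw [← hu0, ← hu1] at h1
              rw [hBud, hm, mul_zero, add_zero]; exact h1
            · have hm : max (D + 3 * lo - 2 * K) 0 = D + 3 * lo - 2 * K := max_eq_left hs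
              have h1 := ltTop_costRho_oneB (lo : ℝ) K g₁ g₂ g₃ D hlo0 hK3R hg hg₂K hg₃K hg11.le h21.le h31.le hDp.le hD2K (by linarith)
              rw [← hu0, ← hu1, ← hu2] at h1
              rw [hBud, hm]; exact h1
          have eT1 : T - 3 * (lo : ℝ) = D + 3 * lo := by linear_combination -hD
          have eT2 : T - (3 * (lo : ℝ) + K) = D + 3 * lo - K := by linear_combination -hD
          have eT3 : T - (3 * (lo : ℝ) + 2 * K) = D + 3 * lo - 2 * K := by linear_combination -hD
          have eT4 : 3 * (lo : ℝ) + 3 * K - T = 3 * K - 3 * lo - D := by linear_combination hD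
          rw [eT1, eT2, eT3, eT4]
          have e3 : 1 - D / (3 * K) = (3 * K - D) / (3 * K) := by rw [sub_div, div_self hK30.ne']
          have eL : (3 * K - 3 * lo - D) * (D / (3 * K)) * (a * u0) = (a / (3 * K)) * ((3 * K - 3 * lo - D) * D * u0) := by
            simp only [div_eq_mul_inv]; ring
          have eRt : (1 - D / (3 * K)) * (a * u0 * (D + 3 * lo) + a * u1 * (D + 3 * lo - K) + a * u2 * max (D + 3 * lo - 2 * K) 0)
              = (a / (3 * K)) * ((3 * K - D) * Bud) := by
            rw [e3, hBud]; simp only [div_eq_mul_inv]; ring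
          rw [eL, eRt]
          exact mul_le_mul_of_nonneg_left keyB (div_nonneg ha0.le hK30.le)
        · -- `θ = y`: `tripleWide4_costTopOne`
          rw [max_eq_left hle, v0, v1, v2]
          have hbrRaw : (K : ℝ) * (g₁ * (1 - g₂) * (1 - g₃) + g₂ * (1 - g₁) * (1 - g₃) + g₃ * (1 - g₁) * (1 - g₂))
              < (T - 6 * (lo : ℝ)) * ((1 - g₁) * (1 - g₂) * (1 - g₃)
                + (g₁ * (1 - g₂) * (1 - g₃) + g₂ * (1 - g₁) * (1 - g₃) + g₃ * (1 - g₁) * (1 - g₂))) := by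
            have h := hbr'; rw [hD, hW, hu0, hu1] at h; exact h
          have hcap2Raw : 2 * (K : ℝ) * (g₁ * g₂ * (1 - g₃) + g₁ * g₃ * (1 - g₂) + g₂ * g₃ * (1 - g₁))
              ≤ (K * (g₁ + g₂ + g₃) - 3 * lo) * ((1 - g₁) * (1 - g₂) * (1 - g₃) + (g₁ * g₂ * (1 - g₃) + g₁ * g₃ * (1 - g₂) + g₂ * g₃ * (1 - g₁))) := by
            have h := hcap2A; rw [hu0, hu2] at h; exact h
          have hTleRaw : T ≤ 3 * (lo : ℝ) + K * (g₁ + g₂ + g₃) := by have h := hTle; rw [hT₀] at h; exact h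
          have hΨT := tripleWide4_costTopOne (lo : ℝ) K g₁ g₂ g₃ x T hlo0 hK3R hK4R hg h12 h13 h21 h31 hx0 hxg hbrRaw hcap2Raw hTleRaw
          rw [← hu0, ← hu1, ← hu2, ← hT₀] at hΨT
          have exT : x * T = y * T₀ := by rw [hy, hT]; ring
          set Bud : ℝ := u0 * (T - 3 * lo) + u1 * (T - (3 * lo + K)) + u2 * max (T - (3 * lo + 2 * K)) 0 with hBud
          set R : ℝ := (1 - y) * Bud - (3 * lo + 3 * K - T) * y * u0 with hR
          have e : (T₀ - x * T) * Bud - (3 * lo + 3 * K - T) * (x * T) * u0 = T₀ * R := by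
            rw [hR, exT]; ring
          have hR0 : 0 ≤ T₀ * R := by rw [← e]; exact hΨT
          have h6 : 0 ≤ R := nonneg_of_mul_nonneg_right hR0 hT0p
          have h7 : 0 ≤ a * R := mul_nonneg ha0.le h6
          rw [hR, hBud] at h7
          linarith [h7]

end LawDec
end Quant
end Summit.CriticalPhenomena.PercolationContinuityZ3.Theorems
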